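import Summits.ResolutionOfSingularities.ResolutionOfSingularities.Theorems.HilbertSamuelEliminationSigmaMaxModificationsCorridor3Directrix214SharpCore
import Literature.AlgebraicGeometry.Resolution.Hironaka1970NearPointInvariantCone
import Literature.AlgebraicGeometry.Resolution.DirectrixScheme
import Literature.AlgebraicGeometry.Resolution.StalkIdealLemmas
import Literature.AlgebraicGeometry.Resolution.BlowupChartMembership
import Literature.AlgebraicGeometry.Resolution.PermissibleCentres
import Literature.RingTheory.HilbertSamuel.ProjDirectrixLiftsTransport
import HarnessLib

/-!
# [OURS · L1 W4.2] 2.14♯ — near points of a point blow-up lie on the projectivised directrix whenever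
# `ē_x(X) ≤ 2·char k(x) − 2` (every residue field): `directrix_nearPoint_of_geomDirDim_le`

Cell res-hironaka, rung L, slot W4.2 (crux `SigmaMaxModificationsCorridor3`, stmt-ResolutionOfSingularities-19249),
typing item T7 (res-L1-w42-plan-1 RULING v3.8-D (D-1), RULINGS v3.9-1 (R5) / v3.9-3 (R)). [OURS · L1 W4.2]
new-combination; NOT a statement of any source, and NOT a statement of H. Hironaka's 2017 manuscript.

STATEMENT (`Directrix214Sharp`, point-centre clause; shape = `CossartJannsenSaito2020.Thm314_point_locus` with
the characteristic hypothesis «`char k(x) = 0 ∨ char k(x) ≥ dim X/2 + 1`» REPLACED by «`0 < char k(x)` and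
`ē_x(X) + 2 ≤ 2·char k(x)`»): for `X` locally noetherian and excellent, `x` a closed point with `{x}` permissible,
`π : X' ⟶ X` a blow-up in `{x}`, `N ≥ dim X`, `x'` over `x` NEAR to `x` (`H^N_{X'}(x') = H^N_X(x)`):
`x' ∈ ℙ(Dir_x(X))` (`IsOnProjDirectrix π x'`).

PROOF (`directrix_nearPoint_of_geomDirDim_le`), from three named facts taken as hypotheses BY NAME —
F14 `Hironaka1970_thmIV_point` ([H4] Th. IV: the tangent-cone ideal `J` is generated inside Hironaka's algebra
`U(𝔭_{x'})` of the point `x'` of `ℙ(T_xX)`), F15 `HironakaScheme.Hironaka1970_thm1_cor` ([H5] Th. 1 Cor., second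
hand: `U` is generated by additive forms), F16″ `HironakaScheme.Mizutani1973_vectorGroup_of_dim_le` (Mizutani 1973:
`dim B ≤ 2p − 2 ⇒ B` vector group) — and the fact-free kernel: the CORE
`Directrix214Sharp.directrixSpace_le_ideal_span_addForm` (…`Directrix214SharpCore.lean`: SHARPENING 1
`dim B ≤ ē` + «additive forms in a linear ideal», giving `𝒯(J) ⊆ U_+S ⊆ 𝔭_{x'}`) and the chart dictionary
`projDirLiftsInto_iff_directrixSpace_le_chartPrime` (`𝒯(J) ⊆ 𝔭_{x'} ⟺ x' ∈ ℙ(Dir)`,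
`Literature/RingTheory/HilbertSamuel/ProjDirectrixChart.lean`). The chart `(t, u)` of the exceptional divisor at
`x'` comes from `IsBlowup.isEffectiveCartier`; the embedding dimension `0` case is vacuous. CAUTION (v3.8-D): the
theorem gives the INCLUSION `x' ∈ ℙ(Dir_x(X))`, not `e_x = ē_x`; the characteristic-`0` branch of (D-1) is CJS
Thm. 3.14 as printed (`CossartJannsenSaito2020_thm_3_14`, `Thm314_point_locus`) and is not re-derived here.

AI-written (res-type-001); AI review is weaker than expert review.
-/

set_option linter.dupNamespace false

noncomputable section

open CategoryTheory AlgebraicGeometry TopologicalSpace IsLocalRing MvPolynomial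
open Literature.AlgebraicGeometry.Resolution Literature.AlgebraicGeometry.Resolution.HironakaScheme
open Literature.RingTheory.HilbertSamuel Literature.RingTheory.MvPolynomial
open Literature.AlgebraicGeometry.CossartJannsenSaito2020

namespace Summit.ResolutionOfSingularities.ResolutionOfSingularities.Theorems.SigmaMaxModificationsCorridor3.Directrix214Sharp

universe u

/-- **[OURS · L1 W4.2] 2.14♯, point-centre clause** (crux-chain w42 RULING v3.8-D (D-1) «`x′` near `x` under a
permissible blow-up with centre `D ∋ x` ⇒ `x′ ∈ ℙ(Dir_x(X)/T_x(D))` whenever `char κ(x) = 0` or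
`ē_x(X) − dim_x D ≤ 2·char κ(x) − 2`», for `D = {x}` and positive characteristic): the binders of
`CossartJannsenSaito2020.Thm314_point_locus` with `CharHypothesis X x` replaced by `0 < char k(x)` and
`ē_x(X) + 2 ≤ 2·char k(x)` (tree `Scheme.geomDirDim`), conclusion `IsOnProjDirectrix π x'`. NOT a statement of
any source; an [OURS] combination. [OURS · L1 W4.2; AI-written] -/
def Directrix214Sharp : Prop :=
  ∀ (X X' : Scheme.{u}) [IsLocallyNoetherian X] (π : X' ⟶ X) (x : X) (hx : IsClosed ({x} : Set X)) (N : ℕ)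
    (x' : X'),
    Scheme.IsExcellent X →
    IdealSheafData.IsPermissible (Scheme.IdealSheafData.vanishingIdeal ⟨{x}, hx⟩) →
    IsBlowup π (Scheme.IdealSheafData.vanishingIdeal ⟨{x}, hx⟩) →
    topologicalKrullDim ↥X ≤ (N : WithBot ℕ∞) → π.base x' = x →
    0 < ringChar (ResidueField (X.presheaf.stalk x)) →
    Scheme.geomDirDim X x + 2 ≤ 2 * ringChar (ResidueField (X.presheaf.stalk x)) →
    Scheme.hsFun X' N x' = Scheme.hsFun X N x → IsOnProjDirectrix π x'

/-! ## Small lemmas -/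

/-- `¬ (q ≤ d + 1) ⇒ d + 2 ≤ q` in `WithBot ℕ∞`. [folklore] -/
theorem add_two_le_of_not_le {d : WithBot ℕ∞} {q : ℕ} (h : ¬ ((q : WithBot ℕ∞) ≤ d + 1)) :
    d + 2 ≤ (q : WithBot ℕ∞) := by
  induction d using WithBot.recBotCoe with
  | bot => exact bot_le
  | coe d =>
    induction d using ENat.recTopCoe with
    | top =>
      exfalso; apply h
      exact le_top.trans (le_of_eq (by rfl))
    | coe m =>
      have h' : ¬ q ≤ m + 1 := by
        intro hle; apply h
        have : ((q : ℕ∞) : WithBot ℕ∞) ≤ (((m + 1 : ℕ) : ℕ∞) : WithBot ℕ∞) :=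
          WithBot.coe_le_coe.mpr (by exact_mod_cast hle)
        simpa using this
      have key : m + 2 ≤ q := by omega
      have : (((m + 2 : ℕ) : ℕ∞) : WithBot ℕ∞) ≤ ((q : ℕ∞) : WithBot ℕ∞) :=
        WithBot.coe_le_coe.mpr (by exact_mod_cast key)
      simpa using this

/-- Additive forms have no constant term (`p^e ≥ 1`). [folklore] -/
theorem constantCoeff_addForm {k : Type u} [Field k] (p : ℕ) [Fact p.Prime] [CharP k p] {n : ℕ} (e : ℕ)
    (a : Fin (n + 1) → k) : constantCoeff (addForm k p e a) = 0 := by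
  simp only [addForm, map_sum, map_mul, constantCoeff_C, map_pow, constantCoeff_X]
  refine Finset.sum_eq_zero fun j _ => ?_
  rw [zero_pow (pow_ne_zero e (Fact.out : p.Prime).ne_zero), mul_zero]

/-- The directrix dimension over an extension does not see a re-indexing of the generators by `Fin.cast`.
[folklore] -/
theorem directrixDim_map_tangentConeIdeal_comp_cast {A : Type u} [CommRing A] [IsLocalRing A] {K : Type u}
    [Field K] (ι : ResidueField A →+* K) {e e' : ℕ} (h : e' = e) {x : Fin e → A}
    (hx : Ideal.span (Set.range x) = maximalIdeal A)
    (hx' : Ideal.span (Set.range (x ∘ Fin.cast h)) = maximalIdeal A) :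
    directrixDim ((tangentConeIdeal (x ∘ Fin.cast h) hx').map (MvPolynomial.map ι)) =
      directrixDim ((tangentConeIdeal x hx).map (MvPolynomial.map ι)) := by
  subst h
  rfl

/-! ## The algebraic assembly at a point of `ℙⁿ` -/

section Algebra

variable {k : Type u} [Field k] (p : ℕ) [Fact p.Prime] [CharP k p] {n : ℕ}

/-- **From the facts to the core**: for a point `𝔭` of `ℙⁿ_k` (`char k = p`) and an ideal `I` generated inside
`U(𝔭)` (shape of F14's conclusion), the facts F15 (`U(𝔭) = k[its additive forms]`) and F16″ (`dim B ≤ 2p − 2 ⇒`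
vector group) together with `ē(I) + 2 ≤ 2p` over a perfect algebraic extension `K` give `𝒯(I) ⊆ 𝔭`.
[OURS · L1 W4.2; AI-written] -/
theorem directrixSpace_le_prime_of_facts (K : Type u) [Field K] [Algebra k K] [CharP K p] [PerfectRing K p]
    [Algebra.IsIntegral k K]
    (h15 : Hironaka1970_thm1_cor.{u} p) (h16 : Mizutani1973_vectorGroup_of_dim_le.{u} p)
    {𝔭 : Ideal (MvPolynomial (Fin (n + 1)) k)} (h𝔭 : IsPoint k 𝔭)
    {I : Ideal (MvPolynomial (Fin (n + 1)) k)}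
    (hI : I ≤ Ideal.span ((I : Set (MvPolynomial (Fin (n + 1)) k)) ∩
      (multAlgebra k 𝔭 : Set (MvPolynomial (Fin (n + 1)) k))))
    (hdir : directrixDim (I.map (MvPolynomial.map (algebraMap k K))) + 2 ≤ 2 * p)
    {f : MvPolynomial (Fin (n + 1)) k} (hf : f ∈ directrixSpace I) : f ∈ 𝔭 := by
  haveI := h𝔭.1
  -- the additive generators of `U(𝔭)`
  set U := multAlgebra k 𝔭 with hU
  set G : Set (MvPolynomial (Fin (n + 1)) k) := {g | g ∈ U ∧ ∃ (e : ℕ) (a : Fin (n + 1) → k), g = addForm k p e a}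
    with hG
  set Aset : Set (ℕ × (Fin (n + 1) → k)) := {ea | addForm k p ea.1 ea.2 ∈ U} with hAset
  have hGA : addFormOf p '' Aset = G := by
    ext g
    constructor
    · rintro ⟨ea, hea, rfl⟩
      exact ⟨hea, ea.1, ea.2, rfl⟩
    · rintro ⟨hg, e, a, rfl⟩
      exact ⟨(e, a), hg, rfl⟩
  have hUG : U = Algebra.adjoin k G := h15 k n 𝔭 h𝔭
  -- F14-shape hypothesis in the core's form
  have hI' : I ≤ Ideal.span ((I : Set (MvPolynomial (Fin (n + 1)) k)) ∩
      (Algebra.adjoin k (addFormOf p '' Aset) : Set (MvPolynomial (Fin (n + 1)) k))) := by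
    rw [hGA, ← hUG]
    exact hI
  -- `(G) · S = U_+ S`
  have hG0 : ∀ g ∈ G, constantCoeff g = 0 := by
    rintro g ⟨-, e, a, rfl⟩
    exact constantCoeff_addForm p e a
  have hspan : Ideal.span (addFormOf p '' Aset) = bIdeal k 𝔭 := by
    rw [hGA]
    apply le_antisymm
    · refine Ideal.span_mono ?_
      rintro g hg
      exact ⟨hg.1, hG0 g hg⟩
    · refine Ideal.span_le.mpr ?_
      rintro u ⟨hu, hu0⟩
      have hu' : u ∈ Algebra.adjoin k G := by rw [← hUG]; exact hu
      have h := sub_C_constantCoeff_mem_ideal_span_of_mem_adjoin hG0 hu'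
      rw [show constantCoeff u = 0 from hu0, C_0, sub_zero] at h
      exact h
  -- Mizutani-shape hypothesis
  have hMiz : Ideal.span (addFormOf p '' Aset) ≠ Ideal.span ((Ideal.span (addFormOf p '' Aset) :
      Set (MvPolynomial (Fin (n + 1)) k)) ∩ (homogeneousSubmodule (Fin (n + 1)) k 1 :
      Set (MvPolynomial (Fin (n + 1)) k))) →
      (2 * p : WithBot ℕ∞) ≤ ringKrullDim (MvPolynomial (Fin (n + 1)) k ⧸ Ideal.span (addFormOf p '' Aset)) + 1 := by
    intro hne
    by_contra hlt
    apply hne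
    rw [hspan] at hlt ⊢
    have hle := add_two_le_of_not_le (q := 2 * p) (by exact_mod_cast hlt)
    exact h16 k n 𝔭 h𝔭 (by exact_mod_cast hle)
  have hmem := directrixSpace_le_ideal_span_addForm p K Aset I hI' hMiz hdir hf
  rw [hspan] at hmem
  exact bIdeal_le hmem

end Algebra

/-! ## The theorem -/

/-- **[OURS · L1 W4.2] 2.14♯ (`directrix_nearPoint_of_geomDirDim_le`)**: from F14 ([H4] Th. IV, point centre),
F15 ([H5] Th. 1 Cor., second-hand) and F16″ (Mizutani 1973) — taken as hypotheses BY NAME — the point clause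
`Directrix214Sharp`: a near point `x'` of the blow-up of an excellent `X` in a closed point `x` lies on
`ℙ(Dir_x(X))` as soon as `0 < p = char k(x)` and `ē_x(X) + 2 ≤ 2p`, for EVERY residue field `k(x)`. Proof: chart
`(t, u)` of the exceptional divisor at `x'` (`IsBlowup.isEffectiveCartier`); F14 puts the tangent-cone ideal `J`
inside `(J ∩ U(𝔭_{x'}))`; `𝔭_{x'}` is a point of `ℙ(T_xX)` (`exists_X_not_mem_chartPrime`); the core gives
`𝒯(J) ⊆ 𝔭_{x'}` (SHARPENING 1 `dim B ≤ ē` + Mizutani + «additive forms in a linear ideal»), and the chart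
dictionary turns this into `IsOnProjDirectrix π x'`. [OURS · L1 W4.2] new-combination; NOT a statement of any
source; AI-written, weaker than expert review. -/
theorem directrix_nearPoint_of_geomDirDim_le (h14 : Hironaka1970_thmIV_point.{u})
    (h15 : ∀ (p : ℕ) [Fact p.Prime], Hironaka1970_thm1_cor.{u} p)
    (h16 : ∀ (p : ℕ) [Fact p.Prime], Mizutani1973_vectorGroup_of_dim_le.{u} p) :
    Directrix214Sharp.{u} := by
  intro X X' _ π x hx N x' hexc hperm hπ hdim hxx' hchar hgeom hnear
  subst hxx'
  set A := X.presheaf.stalk (π.base x') with hA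
  set B := X'.presheaf.stalk x' with hB
  set φ : A →+* B := (π.stalkMap x').hom with hφ
  haveI : IsLocalHom φ := π.toLRSHom.prop x'
  set K := ResidueField A with hK
  set p := ringChar K with hp
  haveI : CharP K p := ringChar.charP K
  haveI hpp : Fact p.Prime := ⟨CharP.char_prime_of_ne_zero K (Nat.pos_iff_ne_zero.mp hchar)⟩
  -- the chart of the exceptional divisor at `x'`
  obtain ⟨t, ht, hspan⟩ := hπ.isEffectiveCartier.exists_stalkIdeal_eq_span x'
  have hmap : (maximalIdeal A).map φ = Ideal.span {t} := by
    rw [← hspan, stalkIdeal_comap_eq_map_stalkMap, stalkIdeal_vanishingIdeal_singleton hx]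
  -- embedding dimension
  rcases Nat.eq_zero_or_pos (maximalIdeal A).spanFinrank with he0 | hepos
  · -- `emb.dim = 0`: no linear forms, the condition is vacuous
    intro L hL c hc
    have hempty : IsEmpty (Fin (maximalIdeal A).spanFinrank) := ⟨fun i => Fin.elim0 (Fin.cast he0 i)⟩
    rw [Finset.univ_eq_empty, Finset.sum_empty, map_zero]
    exact Ideal.zero_mem _
  obtain ⟨n, hn⟩ : ∃ n, (maximalIdeal A).spanFinrank = n + 1 := ⟨_, (Nat.succ_pred_eq_of_pos hepos).symm⟩
  -- the re-indexed minimal generators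
  set g : Fin (n + 1) → A := minGenerators A ∘ Fin.cast hn.symm with hg
  have hgspan : Ideal.span (Set.range g) = maximalIdeal A := by
    have hsurj : Function.Surjective (Fin.cast hn.symm) := fun i => ⟨Fin.cast hn i, by simp⟩
    rw [hg, hsurj.range_comp]
    exact span_range_minGenerators A
  -- `π^♯(g_i) = u_i t`
  have hu : ∀ i, ∃ ui : B, φ (g i) = ui * t := by
    intro i
    have hmem : φ (g i) ∈ (maximalIdeal A).map φ := by
      refine Ideal.mem_map_of_mem φ ?_
      rw [← hgspan]
      exact Ideal.subset_span ⟨i, rfl⟩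
    rw [hmap, Ideal.mem_span_singleton'] at hmem
    obtain ⟨ui, hui⟩ := hmem
    exact ⟨ui, hui.symm⟩
  choose u hu using hu
  -- F14: the tangent-cone ideal is generated inside `U(𝔭_{x'})`
  set J := tangentConeIdeal g hgspan with hJ
  set 𝔭 := chartPrime φ u with h𝔭
  have h14' := h14 X X' π (π.base x') hx N x' hexc hperm hπ hdim rfl hnear (n + 1) g hgspan t u hn ht hmap hu
  -- `𝔭_{x'}` is a point of `ℙ(T_x X)`
  haveI : 𝔭.IsPrime := isPrime_chartPrime φ u
  have hpt : IsPoint K 𝔭 := by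
    refine ⟨isPrime_chartPrime φ u, fun f hf d => homogeneousComponent_mem_chartPrime φ u hf d, ?_⟩
    obtain ⟨i, hi⟩ := exists_X_not_mem_chartPrime φ hgspan ht hmap hu
    intro hle
    exact hi (hle (by simp [irrelevant]))
  -- the geometric directrix dimension of `J`
  set Kbar := AlgebraicClosure K with hKbar
  haveI : PerfectRing Kbar p := PerfectField.toPerfectRing p
  have hdir : directrixDim (J.map (MvPolynomial.map (algebraMap K Kbar))) + 2 ≤ 2 * p := by
    have hgeom' : directrixDim (((canonicalTangentConeIdeal A)).map
        (MvPolynomial.map (algebraMap K Kbar))) + 2 ≤ 2 * p := hgeom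
    rwa [← directrixDim_map_tangentConeIdeal_comp_cast (algebraMap K Kbar) hn.symm
      (span_range_minGenerators A) hgspan] at hgeom'
  -- the core: `𝒯(J) ⊆ 𝔭_{x'}`
  have hcore : ∀ L ∈ directrixSpace J, L ∈ 𝔭 := fun L hL =>
    directrixSpace_le_prime_of_facts p Kbar (h15 p) (h16 p) hpt h14' hdir hL
  -- the chart dictionary, and re-indexing of the minimal generators
  have hlift : ProjDirLiftsInto φ g hgspan :=
    (projDirLiftsInto_iff_directrixSpace_le_chartPrime φ hgspan ht hmap hu).mpr hcore
  exact (projDirLiftsInto_comp_cast_iff φ hn.symm (span_range_minGenerators A) hgspan).mp hlift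

/-- Corollary for the consumers' locus vocabulary: under `Directrix214Sharp`, a near point over `x` lies in
`projDirectrixFibre π x` (the point set of `ℙ(Dir_x(X)) ⊂ π⁻¹(x)`, `KeyTheorems.lean`). [OURS · L1 W4.2; AI-written] -/
theorem mem_projDirectrixFibre_of_near (h : Directrix214Sharp.{u}) {X X' : Scheme.{u}} [IsLocallyNoetherian X]
    {π : X' ⟶ X} {x : X} (hx : IsClosed ({x} : Set X)) {N : ℕ} {x' : X'} (hexc : Scheme.IsExcellent X)
    (hperm : IdealSheafData.IsPermissible (Scheme.IdealSheafData.vanishingIdeal ⟨{x}, hx⟩))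
    (hπ : IsBlowup π (Scheme.IdealSheafData.vanishingIdeal ⟨{x}, hx⟩))
    (hdim : topologicalKrullDim ↥X ≤ (N : WithBot ℕ∞)) (hxx' : π.base x' = x)
    (hchar : 0 < ringChar (ResidueField (X.presheaf.stalk x)))
    (hgeom : Scheme.geomDirDim X x + 2 ≤ 2 * ringChar (ResidueField (X.presheaf.stalk x)))
    (hnear : Scheme.hsFun X' N x' = Scheme.hsFun X N x) : x' ∈ projDirectrixFibre π x :=
  ⟨hxx', h X X' π x hx N x' hexc hperm hπ hdim hxx' hchar hgeom hnear⟩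

end Summit.ResolutionOfSingularities.ResolutionOfSingularities.Theorems.SigmaMaxModificationsCorridor3.Directrix214Sharp

end
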